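import Mathlib.Analysis.Complex.ExponentialBounds
import Summits.QuantumFields.YangMills.Theorems.FemtoTransferGapSpectralSumsTails
import HarnessLib

/-!
# BLOCK-TO-FINE ROOT INEQUALITIES, part 1: POINTWISE real inequalities (door `BlockToFine` of crux idea «block-endpoint» on crux `DressedRitz`,
# stmt-QuantumFields-20205; LEAD prover ym-lead-20205-polyakovlift g4)

The block-to-fine door compares, for a once-block-dressed vector `u = K^ℓ v`, the FINE Rayleigh data (`⟨u,Ku⟩`, `‖Ku‖²`) with the BLOCK data
(`⟨u,K^ℓ u⟩`, `⟨u,K^{2ℓ}u⟩`).  Summed against the spectral measure (`FemtoTransferGapSpectralSumsRoot`), everything reduces to the pointwise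
inequalities of this file in the variable `s = λ/X̄^{1/ℓ}` (`t = s^ℓ`), with `ρ ∈ [1/4,1]` the ratio of the raw to the dressed mean:

* `succ_mul_pow_mul_one_sub_le`: `(ℓ+1)s^ℓ(1−s) ≤ 1 − s^{ℓ+1}` on `[0,1]`;  `pow_sq_mul_sub_one_sq_le` (FAR atoms): `t²(s−1)² ≤ 1/ℓ²`;
* `sub_one_sq_le_of_pow_ge` (NEAR atoms): `(s−1)² ≤ (64/ℓ²)(t−1)²` for `t ≥ 1/8`;  ★ `root_pointwise_c`: `t²(s−1)² ≤ (64/ℓ²)(t²(t−1)² + (t−ρ)²)`;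
* `sub_one_sub_log_le`: `t − 1 − log t ≤ 9(t−1)² + (1−ρ/t)²`;  ★ `root_pointwise_b`: `t²(1 + (t−1)/ℓ) − (9t²(t−1)² + (t−ρ)²)/ℓ ≤ t²·s`;
* `tangent_pow_le` (Bernoulli tangent of `x ↦ x^ℓ`), `cmp_pointwise` (means comparability).

HONEST FRAMING: real-analysis plumbing for the femto-universe infrastructure of the CONDITIONAL rung R2b1; nothing here bears on infinite volume, the
continuum limit or the Clay gap.  References: power-mean / Bernoulli inequalities [folklore]; Reed–Simon IV, Thm. XIII.1 [cite: ReedSimonIV1978, Thm. XIII.1].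
-/

set_option autoImplicit false

noncomputable section

open Finset
open scoped BigOperators

namespace Summit.QuantumFields.YangMills.Theorems.FemtoTransferGap.SpecSum

namespace Root

/-! ## §1 Pointwise inequalities -/

/-- `(ℓ+1)·s^ℓ·(1−s) ≤ 1 − s^{ℓ+1}` on `[0,1]` (one binomial term). [folklore] -/
theorem succ_mul_pow_mul_one_sub_le {s : ℝ} (hs0 : 0 ≤ s) (hs1 : s ≤ 1) (ℓ : ℕ) :
    ((ℓ : ℝ) + 1) * s ^ ℓ * (1 - s) ≤ 1 - s ^ (ℓ + 1) := by
  induction ℓ with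
  | zero => simp
  | succ n ih =>
    have hsn : s ^ (n + 1) ≤ 1 := pow_le_one₀ hs0 hs1
    have hsn0 : 0 ≤ s ^ (n + 1) := pow_nonneg hs0 _
    have h1 : (((n + 1 : ℕ) : ℝ) + 1) * s ^ (n + 1) * (1 - s) =
        s * (((n : ℝ) + 1) * s ^ n * (1 - s)) + s ^ (n + 1) * (1 - s) := by
      push_cast; ring
    have hpow : s ^ (n + 1 + 1) = s ^ (n + 1) * s := pow_succ _ _
    rw [h1, hpow]
    nlinarith [mul_le_mul_of_nonneg_left ih hs0, mul_nonneg (sub_nonneg.2 hsn) (sub_nonneg.2 hs1)]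

/-- FAR root bound: for `s ∈ [0,1]`, `ℓ ≥ 1`: `(s^ℓ)²(s−1)² ≤ 1/ℓ²`. [folklore] -/
theorem pow_sq_mul_sub_one_sq_le {s : ℝ} (hs0 : 0 ≤ s) (hs1 : s ≤ 1) {ℓ : ℕ} (hℓ : 1 ≤ ℓ) :
    (s ^ ℓ) ^ 2 * (s - 1) ^ 2 ≤ 1 / (ℓ : ℝ) ^ 2 := by
  have hℓpos : (0 : ℝ) < ℓ := by exact_mod_cast hℓ
  have h := succ_mul_pow_mul_one_sub_le hs0 hs1 ℓ
  have hx : 0 ≤ s ^ ℓ * (1 - s) := mul_nonneg (pow_nonneg hs0 _) (by linarith)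
  have hx1 : (ℓ : ℝ) * (s ^ ℓ * (1 - s)) ≤ 1 := by nlinarith [pow_nonneg hs0 (ℓ + 1)]
  have hx2 : s ^ ℓ * (1 - s) ≤ 1 / ℓ := by rw [le_div_iff₀ hℓpos]; linarith
  calc (s ^ ℓ) ^ 2 * (s - 1) ^ 2 = (s ^ ℓ * (1 - s)) ^ 2 := by ring
    _ ≤ (1 / (ℓ : ℝ)) ^ 2 := pow_le_pow_left₀ hx hx2 2
    _ = 1 / (ℓ : ℝ) ^ 2 := by rw [div_pow, one_pow]

/-- NEAR root bound: for `s ≥ 0` with `s^ℓ ≥ 1/8`: `(s−1)² ≤ (64/ℓ²)(s^ℓ−1)²` (geometric sum `≥ ℓ/8`). [folklore] -/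
theorem sub_one_sq_le_of_pow_ge {s : ℝ} (hs0 : 0 ≤ s) {ℓ : ℕ} (hℓ : 1 ≤ ℓ) (ht : 1 / 8 ≤ s ^ ℓ) :
    (s - 1) ^ 2 ≤ 64 / (ℓ : ℝ) ^ 2 * (s ^ ℓ - 1) ^ 2 := by
  have hℓpos : (0 : ℝ) < ℓ := by exact_mod_cast hℓ
  have hgeom : (∑ i ∈ range ℓ, s ^ i) * (s - 1) = s ^ ℓ - 1 := geom_sum_mul s ℓ
  have hconst : ∑ _i ∈ range ℓ, (1 : ℝ) / 8 = (ℓ : ℝ) / 8 := by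
    rw [Finset.sum_const, Finset.card_range, nsmul_eq_mul]; ring
  have hsum : (ℓ : ℝ) / 8 ≤ ∑ i ∈ range ℓ, s ^ i := by
    rw [← hconst]
    refine Finset.sum_le_sum fun i hi => ?_
    rcases le_or_gt 1 s with hs1 | hs1
    · have : (1 : ℝ) ≤ s ^ i := one_le_pow₀ hs1
      linarith
    · have hi' : i ≤ ℓ := (mem_range.1 hi).le
      have : s ^ ℓ ≤ s ^ i := pow_le_pow_of_le_one hs0 hs1.le hi'
      linarith
  have hG : 0 ≤ ∑ i ∈ range ℓ, s ^ i := le_trans (by positivity) hsum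
  have habs : |s - 1| * ((ℓ : ℝ) / 8) ≤ |s ^ ℓ - 1| := by
    calc |s - 1| * ((ℓ : ℝ) / 8) ≤ |s - 1| * ∑ i ∈ range ℓ, s ^ i := mul_le_mul_of_nonneg_left hsum (abs_nonneg _)
      _ = |(∑ i ∈ range ℓ, s ^ i) * (s - 1)| := by rw [abs_mul, abs_of_nonneg hG, mul_comm]
      _ = |s ^ ℓ - 1| := by rw [hgeom]
  have hsq : (|s - 1| * ((ℓ : ℝ) / 8)) ^ 2 ≤ |s ^ ℓ - 1| ^ 2 := pow_le_pow_left₀ (by positivity) habs 2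
  rw [mul_pow, sq_abs, sq_abs] at hsq
  rw [div_mul_eq_mul_div, le_div_iff₀ (by positivity)]
  nlinarith [hsq]

/-- ★ (c)-POINTWISE: for `s ≥ 0`, `ρ ∈ [1/4,1]`, `ℓ ≥ 1`, with `t = s^ℓ`:  `t²(s−1)² ≤ (64/ℓ²)(t²(t−1)² + (t−ρ)²)`. [folklore] -/
theorem root_pointwise_c {s ρ : ℝ} (hs0 : 0 ≤ s) (hρ : 1 / 4 ≤ ρ) (_hρ1 : ρ ≤ 1) {ℓ : ℕ} (hℓ : 1 ≤ ℓ) :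
    (s ^ ℓ) ^ 2 * (s - 1) ^ 2 ≤ 64 / (ℓ : ℝ) ^ 2 * ((s ^ ℓ) ^ 2 * (s ^ ℓ - 1) ^ 2 + (s ^ ℓ - ρ) ^ 2) := by
  have hℓpos : (0 : ℝ) < ℓ := by exact_mod_cast hℓ
  rcases le_or_gt (1 / 8 : ℝ) (s ^ ℓ) with ht | ht
  · have h := sub_one_sq_le_of_pow_ge hs0 hℓ ht
    have h2 : 0 ≤ 64 / (ℓ : ℝ) ^ 2 * (s ^ ℓ - ρ) ^ 2 := by positivity
    calc (s ^ ℓ) ^ 2 * (s - 1) ^ 2 ≤ (s ^ ℓ) ^ 2 * (64 / (ℓ : ℝ) ^ 2 * (s ^ ℓ - 1) ^ 2) :=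
          mul_le_mul_of_nonneg_left h (by positivity)
      _ = 64 / (ℓ : ℝ) ^ 2 * ((s ^ ℓ) ^ 2 * (s ^ ℓ - 1) ^ 2) := by ring
      _ ≤ _ := by nlinarith [h2]
  · have hs1 : s ≤ 1 := by
      rcases le_or_gt s 1 with h | h
      · exact h
      · have : (1 : ℝ) ≤ s ^ ℓ := one_le_pow₀ h.le
        linarith
    have hfar := pow_sq_mul_sub_one_sq_le hs0 hs1 hℓ
    have hgap0 : (1 : ℝ) / 8 ≤ ρ - s ^ ℓ := by linarith
    have hgap : (1 : ℝ) / 64 ≤ (s ^ ℓ - ρ) ^ 2 := by nlinarith [hgap0]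
    have h1 : 0 ≤ 64 / (ℓ : ℝ) ^ 2 * ((s ^ ℓ) ^ 2 * (s ^ ℓ - 1) ^ 2) := by positivity
    calc (s ^ ℓ) ^ 2 * (s - 1) ^ 2 ≤ 1 / (ℓ : ℝ) ^ 2 := hfar
      _ = 64 / (ℓ : ℝ) ^ 2 * (1 / 64) := by ring
      _ ≤ 64 / (ℓ : ℝ) ^ 2 * (s ^ ℓ - ρ) ^ 2 := mul_le_mul_of_nonneg_left hgap (by positivity)
      _ ≤ _ := by nlinarith [h1]

/-- `log 8 < 2.08`. [folklore] -/
theorem log_eight_lt : Real.log 8 < 2.08 := by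
  have h : Real.log 8 = 3 * Real.log 2 := by
    rw [show (8 : ℝ) = 2 ^ 3 by norm_num, Real.log_pow]; norm_num
  rw [h]
  have := Real.log_two_lt_d9
  linarith

/-- ★ LOG BOUND: for `t > 0`, `ρ ∈ [1/4,1]`: `t − 1 − log t ≤ 9(t−1)² + (1 − ρ/t)²` (near: `log t ≥ 1 − 1/t`; far: `log(1/(8t)) ≤ 1/(8t) − 1`). [folklore] -/
theorem sub_one_sub_log_le {t ρ : ℝ} (ht : 0 < t) (hρ : 1 / 4 ≤ ρ) (_hρ1 : ρ ≤ 1) :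
    t - 1 - Real.log t ≤ 9 * (t - 1) ^ 2 + (1 - ρ / t) ^ 2 := by
  have hsq : 0 ≤ (1 - ρ / t) ^ 2 := sq_nonneg _
  rcases le_or_gt (1 / 2 : ℝ) t with h12 | h12
  · have hlog : 1 - t⁻¹ ≤ Real.log t := Real.one_sub_inv_le_log_of_pos ht
    have hinv : t⁻¹ ≤ 2 := by rw [inv_le_comm₀ ht (by norm_num)]; linarith
    have hid : (t - 1) ^ 2 * t⁻¹ = t - 2 + t⁻¹ := by field_simp; ring
    have h1 : t - 1 - Real.log t ≤ (t - 1) ^ 2 * t⁻¹ := by rw [hid]; linarith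
    nlinarith [sq_nonneg (t - 1), mul_le_mul_of_nonneg_left hinv (sq_nonneg (t - 1))]
  · have h9 : (9 : ℝ) / 4 ≤ 9 * (t - 1) ^ 2 := by nlinarith
    have hl8 := log_eight_lt
    rcases le_or_gt t (ρ / 2) with hfar | hmid
    · have h8t : 0 < 1 / (8 * t) := by positivity
      have hlog1 : Real.log (1 / (8 * t)) ≤ 1 / (8 * t) - 1 := Real.log_le_sub_one_of_pos h8t
      have hlog8 : Real.log (1 / (8 * t)) = -(Real.log 8 + Real.log t) := by
        rw [Real.log_div one_ne_zero (by positivity), Real.log_one, Real.log_mul (by norm_num) ht.ne', zero_sub]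
      rw [hlog8] at hlog1
      have hrt : 2 ≤ ρ / t := by rw [le_div_iff₀ ht]; linarith
      have hA : 1 / (8 * t) ≤ (1 - ρ / t) ^ 2 := by
        have h1 : 1 ≤ ρ / t - 1 := by linarith
        have h2 : 1 / (8 * t) ≤ ρ / t - 1 := by
          have h3 : 1 / (8 * t) ≤ (ρ / t) / 2 := by
            rw [div_div, div_le_div_iff₀ (by positivity) (by positivity)]; nlinarith
          linarith
        calc 1 / (8 * t) ≤ (ρ / t - 1) * 1 := by linarith
          _ ≤ (ρ / t - 1) * (ρ / t - 1) := mul_le_mul_of_nonneg_left h1 (by linarith)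
          _ = (1 - ρ / t) ^ 2 := by ring
      linarith
    · have ht8 : 1 / 8 ≤ t := by linarith
      have hlogt : -Real.log t ≤ Real.log 8 := by
        have h1 : Real.log (1 / 8) ≤ Real.log t := Real.log_le_log (by norm_num) ht8
        rw [Real.log_div one_ne_zero (by norm_num), Real.log_one, zero_sub] at h1
        linarith
      linarith

/-- ★ (b′)-POINTWISE (polynomial form of `s ≥ 1 + log s`): for `s ≥ 0`, `ρ ∈ [1/4,1]`, `ℓ ≥ 1`, `t = s^ℓ`:
`t²(1 + (t−1)/ℓ) − (9t²(t−1)² + (t−ρ)²)/ℓ ≤ t²·s`. [folklore] -/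
theorem root_pointwise_b {s ρ : ℝ} (hs0 : 0 ≤ s) (hρ : 1 / 4 ≤ ρ) (hρ1 : ρ ≤ 1) {ℓ : ℕ} (hℓ : 1 ≤ ℓ) :
    (s ^ ℓ) ^ 2 * (1 + (s ^ ℓ - 1) / ℓ) - (9 * (s ^ ℓ) ^ 2 * (s ^ ℓ - 1) ^ 2 + (s ^ ℓ - ρ) ^ 2) / ℓ ≤ (s ^ ℓ) ^ 2 * s := by
  have hℓpos : (0 : ℝ) < ℓ := by exact_mod_cast hℓ
  have hℓne : ℓ ≠ 0 := by omega
  rcases hs0.eq_or_lt with hs | hs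
  · subst hs
    rw [zero_pow hℓne]
    have : 0 ≤ (9 * (0 : ℝ) ^ 2 * (0 - 1) ^ 2 + (0 - ρ) ^ 2) / ℓ := by positivity
    nlinarith [this]
  · have htpos : 0 < s ^ ℓ := pow_pos hs _
    set t := s ^ ℓ with htdef
    -- s ≥ 1 + log s, log s = log t / ℓ
    have hexp : 1 + Real.log s ≤ s := by
      have := Real.add_one_le_exp (Real.log s)
      rw [Real.exp_log hs] at this; linarith
    have hlogs : Real.log s = Real.log t / ℓ := by
      rw [htdef, Real.log_pow, mul_div_cancel_left₀ _ hℓpos.ne']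
    have hg := sub_one_sub_log_le htpos hρ hρ1
    -- log t ≥ (t-1) - 9(t-1)^2 - (1-ρ/t)^2
    have hlogt : (t - 1) - 9 * (t - 1) ^ 2 - (1 - ρ / t) ^ 2 ≤ Real.log t := by linarith
    have hs_ge : 1 + ((t - 1) - 9 * (t - 1) ^ 2 - (1 - ρ / t) ^ 2) / ℓ ≤ s := by
      have : ((t - 1) - 9 * (t - 1) ^ 2 - (1 - ρ / t) ^ 2) / ℓ ≤ Real.log t / ℓ :=
        div_le_div_of_nonneg_right hlogt hℓpos.le
      linarith
    have ht2 : 0 ≤ t ^ 2 := sq_nonneg _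
    have hmul := mul_le_mul_of_nonneg_left hs_ge ht2
    have hid : t ^ 2 * (1 - ρ / t) ^ 2 = (t - ρ) ^ 2 := by
      field_simp
    calc t ^ 2 * (1 + (t - 1) / ℓ) - (9 * t ^ 2 * (t - 1) ^ 2 + (t - ρ) ^ 2) / ℓ
        = t ^ 2 * (1 + ((t - 1) - 9 * (t - 1) ^ 2 - (1 - ρ / t) ^ 2) / ℓ) := by
          rw [← hid]; field_simp; ring
      _ ≤ t ^ 2 * s := hmul

/-- TANGENT of `x ↦ x^ℓ` at `y > 0`: `y^ℓ + ℓ y^{ℓ-1}(x − y) ≤ x^ℓ` for `x ≥ 0` (Bernoulli). [folklore] -/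
theorem tangent_pow_le {x y : ℝ} (hx : 0 ≤ x) (hy : 0 < y) {ℓ : ℕ} (hℓ : 1 ≤ ℓ) :
    y ^ ℓ + ℓ * y ^ (ℓ - 1) * (x - y) ≤ x ^ ℓ := by
  obtain ⟨n, rfl⟩ : ∃ n, ℓ = n + 1 := ⟨ℓ - 1, by omega⟩
  have ha : -2 ≤ x / y - 1 := by
    have : 0 ≤ x / y := div_nonneg hx hy.le
    linarith
  have hB := one_add_mul_le_pow ha (n + 1)
  have hxy : 1 + (x / y - 1) = x / y := by ring
  rw [hxy, div_pow] at hB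
  have hyp : 0 < y ^ (n + 1) := pow_pos hy _
  have h2 := mul_le_mul_of_nonneg_left hB hyp.le
  have hR : y ^ (n + 1) * (x ^ (n + 1) / y ^ (n + 1)) = x ^ (n + 1) := by
    field_simp
  have hyx : y ^ (n + 1) * (x / y) = y ^ n * x := by
    rw [pow_succ]; field_simp
  have hid : y ^ (n + 1) * (1 + ((n + 1 : ℕ) : ℝ) * (x / y - 1)) =
      y ^ (n + 1) + ((n + 1 : ℕ) : ℝ) * y ^ (n + 1 - 1) * (x - y) := by
    rw [Nat.add_sub_cancel]
    have : y ^ (n + 1) * (1 + ((n + 1 : ℕ) : ℝ) * (x / y - 1)) =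
        y ^ (n + 1) + ((n + 1 : ℕ) : ℝ) * (y ^ (n + 1) * (x / y)) - ((n + 1 : ℕ) : ℝ) * y ^ (n + 1) := by ring
    rw [this, hyx, pow_succ]; ring
  rw [hid, hR] at h2
  exact h2

/-- MEANS-COMPARABILITY POINTWISE: if `0 ≤ m`, `4m ≤ X̄`, then for every `X ≥ 0`: `X²X̄² ≤ 4X²(X−X̄)² + 4X̄²(X−m)²`. [folklore] -/
theorem cmp_pointwise {X m Xb : ℝ} (hX : 0 ≤ X) (hm : 0 ≤ m) (h4 : 4 * m ≤ Xb) :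
    X ^ 2 * Xb ^ 2 ≤ 4 * (X ^ 2 * (X - Xb) ^ 2) + 4 * (Xb ^ 2 * (X - m) ^ 2) := by
  rcases le_or_gt X (2 * m) with h | h
  · have h1 : Xb / 2 ≤ Xb - X := by linarith
    have h2 : Xb ^ 2 / 4 ≤ (X - Xb) ^ 2 := by nlinarith [h1]
    nlinarith [mul_le_mul_of_nonneg_left h2 (sq_nonneg X), sq_nonneg (X - m), sq_nonneg Xb]
  · have h1 : X / 2 ≤ X - m := by linarith
    have h2 : X ^ 2 / 4 ≤ (X - m) ^ 2 := by nlinarith [h1]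
    nlinarith [mul_le_mul_of_nonneg_left h2 (sq_nonneg Xb), sq_nonneg (X - Xb), sq_nonneg X]

end Root

end Summit.QuantumFields.YangMills.Theorems.FemtoTransferGap.SpecSum

end
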